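import Literature.MathematicalPhysics.QuantumFieldTheory.Balaban1983to89.B7Prop3GeneralLinearSplit
import Literature.MathematicalPhysics.QuantumFieldTheory.Balaban1983to89.B8Ineq132

/-!
# `Balaban1983to89.B9Eq3113Proof` — T. Bałaban, *Propagators for lattice gauge theories in a background field*,
Commun. Math. Phys. **99** (1985) 389–434 [Balaban1985BackgroundPropagators]: (3.113) p. 418 — the one-step average
`Ū′` of a PURE GAUGE `U′ = 1^u` at a background `U`, exactly, and its linear part along `u = e^{−tλ}`
(= the right-hand side `(D_ŪQ′λ)(c)` of (3.114)), PROVED for [5]'s concrete average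

statement-level skeleton of published theorems with citation tags; proofs where landed; nothing here is a claim about the Yang–Mills mass gap

PDF held: `paper:balaban1985-cmp99-background-propagators` (journal page = PDF page + 388); [5] = T. Bałaban, *Averaging
operations for lattice gauge theories*, CMP **98** (1985) 17–51 [Balaban1985Averaging] (`paper:balaban1985-cmp98-averaging`,
journal page = PDF page + 16).

CITATION HEADER / WHAT IS REPRODUCED.  SKELETON row **B9.Eq3.113** ((3.113)–(3.115) p. 418 [PDF 30]) of the cell
`lit-balaban` (HOME `run/shared/lean/pub/lit-balaban/`, Phase-2 reserve R10, seat p06 = unit `lit-balaban-p06`), file 1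
of 2 (file 2 = `B9Eq3114Proof`: (3.114) and (3.115)).  p. 418, verbatim: *"Let us investigate how the averaging operators
act on gauge transformed configurations. The linear gauge transformations were defined as A → A − Dλ, and
Q_j(A − Dλ) = Q_jA − Q_jDλ, hence it is enough to investigate averaging operators acting on gauge transformations. We use
the fact that a linear gauge transformation defined by λ is a linear part of the transformation U′ → U′_u defined by
u = e^{iλ}, and we study at first the non-linear averaging operation acting on the non-linear gauge transformation. We
consider the one-step average Ū′_c = (R_{c₋}U′‾)⁻¹(U′U)‾_c(Ū_c)⁻¹R̄_cR_{c₊}U′‾, where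
R_yU′‾ = exp[Σ_{x∈B(y)} L^{−d} log(R_yU′)(Γ_{y,x})] (3.113) and we calculate it for U′_u with U′ = 1, thus for
U′(x,x′) = u(x)R(U(x,x′))u⁻¹(x′). We have (U′U)‾_c = u(c₋)Ū_cu⁻¹(c₊) … hence Ū′_c = (R̄u)(c₋)R̄_c(R̄u)⁻¹(c₊). Taking
logarithms of both sides, and linear parts in λ, we obtain (QD^{L⁻¹}λ)(c) = R̄_c(Q′λ)(c₊) − (Q′λ)(c₋) = (D_ŪQ′λ)(c).
(3.114)"*.  CARRIERS (all REUSED BY NAME from the tree's concrete [5]-lineage, nothing restated): the one-step average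
(3.113) IS [5] (89) `B7Eq92Concrete.dbavgCov L U U′` with block frames `R_yU′‾` = `B7Eq92Concrete.wframe` ((82)/(62)),
twisted transports `(R_yU′)(Γ)` = `B7Eq92Concrete.tHol` (58), `(U′U)‾_cŪ_c⁻¹` = `B7Eq92Concrete.tild` (65), `Ū = bavg L U`
(42), `R(X)Y = XYX⁻¹` = `B7Eq78Linearization.conjR` / `B7Eq92Concrete.Rc` (56); the pure gauge `U′ = 1^u` is the moving-frame
transform (55) `B7Eq92Concrete.mgauge U u 1`; `Q′` (3.18)–(3.19) is `B7Eq78Linearization.Qprime` on [5]'s blocks (`Qp`);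
`D_U` (3.3) is `B8Ineq132.covDerivFwd 1` (`Dcov`); `log` = the series (21) of [5] (`MatrixLog.mlog`), values in a complete
normed `ℂ`-algebra `𝔸` (lineage convention: the `i` absorbed into `λ`, complex parameter `t`).
WHAT THIS FILE PROVES (kernel, 0 sorry, axioms ⊆ {propext, Classical.choice, Quot.sound}; NO smallness anywhere in this
file): §1 the objects and the tangent `d/dt|₀U′_t(b) = (D_Uλ)(b)` of the pure-gauge family `U′_t` of `u_t = e^{−tλ}`
(`hasDerivAt_mgauge_uexp`, = (3.116) to first order); §2 **(3.113) for the pure gauge, EXACTLY** — `tHol_pureGauge`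
(`(R_yU′)(Γ_{y,x}) = u(y)[R(U(Γ_{y,x}))u(x)]⁻¹`), `tild_pureGauge` (*"(U′U)‾_c = u(c₋)Ū_cu⁻¹(c₊)"*), `dbavgCov_pureGauge`
(*"Ū′_c = (R̄u)(c₋)R̄_c(R̄u)⁻¹(c₊)"* with `(R̄u)(y)` READ AS `ρ(y) := (R_yU′‾)⁻¹u(y)` — print's *"R_yU′‾ = u(y)(R̄u)⁻¹(y)"*
taken as the definition of the symbol; its identification with [5] (78) `B7Eq78Linearization.avgStep` needs
`log(X⁻¹) = −log X` for the series logarithm, i.e. smallness, and is NOT made here — at the linearised level it is exact: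
`ρ_t` has derivative `−(Q′λ) = Q′(−λ)`, the linear part of `R̄(e^{−tλ})` by `B7Eq78Linearization.hasDerivAt_avgStep`);
§3 **"taking logarithms … and linear parts in λ"** — `hasDerivAt_Fcov_uexp` (the frame exponent has derivative
`Q′λ − λ`), `hasDerivAt_mlog_dbavgCov_uexp`: `d/dt|₀ log Ū′_t(c) = R̄_c(Q′λ)(c₊) − (Q′λ)(c₋)` for EVERY background, every
`λ`, every `L ≥ 1`.  File 2 identifies the left-hand side with the linear part «L(Q(U)·)» of [5] (121)–(122) at `A = D_Uλ`.
NOT HERE: any estimate; the non-linear identification of `ρ` with (78); Q′ in the collapsed form (3.19) with the composite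
contours (52)–(53) of [5].
-/

noncomputable section

open scoped BigOperators Topology
open NormedSpace Finset

namespace Literature.MathematicalPhysics.QuantumFieldTheory.Balaban1983to89.B9Eq3113Proof

open B7Prop1Explicit B7Prop2Explicit B7Prop3Flat B7Eq92Concrete MatrixLog B7Prop3GeneralLinear
  B7Prop3GeneralRotated
open B7Prop3GeneralLinearSplit (sum_blockWeight)
open B7Eq78Linearization (conjR conjR_apply conjR_one conjR_add conjR_sub conjR_smul hasDerivAt_mlog_comp
  hasDerivAt_exp_comp_zero hasDerivAt_conjR_comp hasDerivAt_exp_smul_zero Qprime Qprime_apply)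
open B8Ineq132 (covDerivFwd)

-- `Site` alone would resolve to the torus sites of `Setup.lean`; re-export the `ℤ^d` sites of `B7Prop1Explicit`.
export B7Prop1Explicit (Site)

variable {d : ℕ}
variable {𝔸 : Type*} [NormedRing 𝔸] [NormedAlgebra ℂ 𝔸] [CompleteSpace 𝔸]

/-! ## §1 The objects of (3.114): `Q′` (3.18)–(3.19) one step, `D_U` (3.3), the pure gauge `U′` of p. 418 -/

section Objects

variable (L : ℕ)

omit [CompleteSpace 𝔸] in
/-- **(3.18)–(3.19), one step** p. 393 [PDF 5]: *"(Q′(V)λ)(y) = Σ_{x∈B(y)} L^{−d}R(V(Γ_{y,x}))λ(x)"* — for [5]'s blocks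
`B(y) = y + [0, L)^d` (`boxVec`) and tree contours `Γ_{y,x}` (`treeWord`), `R(X)Y = XYX⁻¹` (`conjR`); it IS the (3.19)
carrier `B7Eq78Linearization.Qprime` on this block (by definition). [cite: Balaban1985BackgroundPropagators, (3.18)–(3.19) p.393] -/
def Qp (V : Site d → Fin d → 𝔸ˣ) (lam : Site d → 𝔸) (y : Site d) : 𝔸 :=
  Qprime (Finset.univ : Finset (Fin d → Fin L)) (fun _ => ((L : ℝ) ^ d)⁻¹)
    (fun r => hol V y (treeWord (boxVec L r))) (fun r => lam (y + boxVec L r))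

omit [CompleteSpace 𝔸] in
/-- `(Q′(V)λ)(y) = Σ_{x∈B(y)} L^{−d}R(V(Γ_{y,x}))λ(x)` unfolded. [cite: Balaban1985BackgroundPropagators, (3.19) p.393] -/
theorem Qp_eq_sum (V : Site d → Fin d → 𝔸ˣ) (lam : Site d → 𝔸) (y : Site d) :
    Qp L V lam y = ∑ r : Fin d → Fin L,
      (((L : ℝ) ^ d)⁻¹) • conjR (hol V y (treeWord (boxVec L r))) (lam (y + boxVec L r)) := rfl

omit [CompleteSpace 𝔸] in
/-- **(3.3)** p. 390–391 [PDF 2–3]: *"(D^η_{U₀}A)(b) = η⁻¹(R(U₀(b))A(b₊) − A(b₋))"*, for a site function (print's `A`,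
here `λ`) on the unit lattice (`η = 1`), as a bond function on `b = ⟨x, x + e_μ⟩`; it IS the tree's forward covariant
derivative `B8Ineq132.covDerivFwd 1`. [cite: Balaban1985BackgroundPropagators, (3.3) p.391] -/
def Dcov (V : Site d → Fin d → 𝔸ˣ) (lam : Site d → 𝔸) : Site d → Fin d → 𝔸 := fun x μ => covDerivFwd 1 V μ lam x

omit [CompleteSpace 𝔸] in
/-- `(D_Vλ)(⟨x, x + e_μ⟩) = R(V(x, x + e_μ))λ(x + e_μ) − λ(x)`. [cite: Balaban1985BackgroundPropagators, (3.3) p.391] -/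
theorem Dcov_apply (V : Site d → Fin d → 𝔸ˣ) (lam : Site d → 𝔸) (x : Site d) (μ : Fin d) :
    Dcov V lam x μ = conjR (V x μ) (lam (x + e μ)) - lam x := by
  simp [Dcov, covDerivFwd]

/-- the one-parameter family of gauge transformations `u_t = e^{−tλ}` (print: `u = e^{iλ}`; lineage convention: the `i`
absorbed into `λ`, complex parameter `t`; the sign makes the tangent of `U′` at `t = 0` equal to `+D_Uλ`, cf. p. 393
*"A^λ = A − Dλ"*). [cite: Balaban1985BackgroundPropagators, p.418 (3.113)–(3.114)] -/
def uexp (lam : Site d → 𝔸) (t : ℂ) : Site d → 𝔸ˣ := fun x => expUnit (-(t • lam x))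

omit [NormedAlgebra ℂ 𝔸] [CompleteSpace 𝔸] in
/-- p. 418 [PDF 30]: *"we calculate it for U′_u with U′ = 1, thus for U′(x,x′) = u(x)R(U(x,x′))u⁻¹(x′)"* — the pure gauge
`U′ = 1^u` relative to the background `U` is [5]'s moving-frame transform (55) of the unit configuration
(`B7Eq92Concrete.mgauge U u 1`): `U′(x, x + e_κ) = u(x)·R(U(x, x + e_κ))u(x + e_κ)⁻¹`. [cite: Balaban1985BackgroundPropagators, p.418 (3.113)] -/
theorem val_mgauge_one (U : Site d → Fin d → 𝔸ˣ) (u : Site d → 𝔸ˣ) (x : Site d) (κ : Fin d) :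
    ((mgauge U u 1 x κ : 𝔸ˣ) : 𝔸) = (u x : 𝔸) * conjR (U x κ) (((u (x + e κ))⁻¹ : 𝔸ˣ) : 𝔸) := by
  rw [mgauge_apply, Pi.one_apply, Pi.one_apply, mul_one, ← map_inv, Units.val_mul, Rc_apply, Units.val_mul,
    Units.val_mul, conjR_apply]

/-- along `u_t = e^{−tλ}`: `U′_t(x, x + e_κ) = e^{−tλ(x)}·e^{tR(U(x,x+e_κ))λ(x+e_κ)}`. [cite: Balaban1985BackgroundPropagators, p.418 (3.113)] -/
theorem val_mgauge_uexp (U : Site d → Fin d → 𝔸ˣ) (lam : Site d → 𝔸) (t : ℂ) (x : Site d) (κ : Fin d) :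
    ((mgauge U (uexp lam t) 1 x κ : 𝔸ˣ) : 𝔸)
      = exp (-(t • lam x)) * exp (t • conjR (U x κ) (lam (x + e κ))) := by
  letI : NormedAlgebra ℚ 𝔸 := NormedAlgebra.restrictScalars ℚ ℂ 𝔸
  rw [val_mgauge_one, uexp, uexp, val_expUnit, val_inv_expUnit, val_expUnit, neg_neg, conjR_apply,
    ← exp_units_conj, ← conjR_apply, conjR_smul]

/-- at `t = 0` the gauge transformation is the identity and `U′_0 = 1`. [cite: Balaban1985BackgroundPropagators, p.418 (3.113)] -/
theorem mgauge_uexp_zero (U : Site d → Fin d → 𝔸ˣ) (lam : Site d → 𝔸) :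
    mgauge U (uexp lam 0) 1 = 1 := by
  funext x κ
  exact Units.ext (by rw [val_mgauge_uexp, zero_smul, neg_zero, zero_smul, exp_zero, one_mul, Pi.one_apply,
    Pi.one_apply, Units.val_one])

/-- the tangent of the pure-gauge family at `t = 0` is the covariant derivative: `d/dt|₀ U′_t(b) = (D_Uλ)(b)` — the
linear part *"A^λ = A − Dλ"* (p. 393) of the gauge action, print's (3.116) to first order.
[cite: Balaban1985BackgroundPropagators, (3.116) p.418, p.393] -/
theorem hasDerivAt_mgauge_uexp (U : Site d → Fin d → 𝔸ˣ) (lam : Site d → 𝔸) (x : Site d) (κ : Fin d) :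
    HasDerivAt (fun t : ℂ => ((mgauge U (uexp lam t) 1 x κ : 𝔸ˣ) : 𝔸)) (Dcov U lam x κ) 0 := by
  simp only [val_mgauge_uexp]
  have h1 : HasDerivAt (fun t : ℂ => exp (-(t • lam x))) (-lam x) 0 := by
    simpa only [smul_neg] using hasDerivAt_exp_smul_zero (-lam x)
  have h2 := hasDerivAt_exp_smul_zero (conjR (U x κ) (lam (x + e κ)))
  have h := h1.fun_mul h2
  simp only [zero_smul, neg_zero, exp_zero, mul_one, one_mul] at h
  rw [Dcov_apply]
  exact h.congr_deriv (by abel)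

end Objects

/-! ### Linearity, the composites `Q′_j` (3.19), and the bound `|Q′μ| ≤ sup|μ|` -/

section Composites

variable (L : ℕ)

omit [CompleteSpace 𝔸] in
/-- `Q′` is `ℂ`-linear (homogeneity). [cite: Balaban1985BackgroundPropagators, (3.19) p.393] -/
theorem Qp_smul (V : Site d → Fin d → 𝔸ˣ) (c : ℂ) (lam : Site d → 𝔸) (y : Site d) :
    Qp L V (c • lam) y = c • Qp L V lam y := by
  rw [Qp_eq_sum, Qp_eq_sum, Finset.smul_sum]
  refine Finset.sum_congr rfl fun r _ => ?_
  rw [Pi.smul_apply, conjR_smul, smul_comm]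

omit [CompleteSpace 𝔸] in
/-- `D_V` is `ℂ`-linear (homogeneity). [cite: Balaban1985BackgroundPropagators, (3.3) p.391] -/
theorem Dcov_smul (V : Site d → Fin d → 𝔸ˣ) (c : ℂ) (lam : Site d → 𝔸) :
    Dcov V (c • lam) = c • Dcov V lam := by
  funext x μ
  rw [Pi.smul_apply, Pi.smul_apply, Dcov_apply, Dcov_apply, Pi.smul_apply, Pi.smul_apply, conjR_smul, smul_sub]

/-- **(3.19), the composite** p. 393 [PDF 5]: *"(Q′_j(U)λ)(y) = (Q′(Ū^{j−1})·…·Q′(Ū)Q′(U)λ)(y)"* (first form), each level read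
on the unit lattice after rescaling by `L` (`Ū^j = avgIter L U j` of [5] (43)): `Q′_0λ = λ`,
`(Q′_{j+1}λ)(z) = (Q′(Ū^j)Q′_jλ)(Lz)`. [cite: Balaban1985BackgroundPropagators, (3.19) p.393] -/
def QpIter (U : Site d → Fin d → 𝔸ˣ) (lam : Site d → 𝔸) : ℕ → Site d → 𝔸
  | 0 => lam
  | j + 1 => fun z => Qp L (avgIter L U j) (QpIter U lam j) ((L : ℤ) • z)

/-- `Q′_0λ = λ`. [cite: Balaban1985BackgroundPropagators, (3.19) p.393] -/
@[simp] theorem QpIter_zero (U : Site d → Fin d → 𝔸ˣ) (lam : Site d → 𝔸) : QpIter L U lam 0 = lam := rfl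

/-- `(Q′_{j+1}λ)(z) = (Q′(Ū^j)Q′_jλ)(Lz)`. [cite: Balaban1985BackgroundPropagators, (3.19) p.393] -/
theorem QpIter_succ (U : Site d → Fin d → 𝔸ˣ) (lam : Site d → 𝔸) (j : ℕ) (z : Site d) :
    QpIter L U lam (j + 1) z = Qp L (avgIter L U j) (QpIter L U lam j) ((L : ℤ) • z) := rfl

/-- `Q′_j` is `ℂ`-homogeneous. [cite: Balaban1985BackgroundPropagators, (3.19) p.393] -/
theorem QpIter_smul (U : Site d → Fin d → 𝔸ˣ) (c : ℂ) (lam : Site d → 𝔸) :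
    ∀ j : ℕ, QpIter L U (c • lam) j = c • QpIter L U lam j
  | 0 => rfl
  | j + 1 => by
      funext z
      rw [QpIter_succ, QpIter_smul U c lam j, Qp_smul, Pi.smul_apply, QpIter_succ]

variable [NormOneClass 𝔸]

omit [CompleteSpace 𝔸] in
/-- `|(Q′(V)μ)(y)| ≤ sup|μ|` for a background with `|V_b|, |V_b⁻¹| ≤ 1` (an average of rotated values).
[cite: Balaban1985BackgroundPropagators, (3.19) p.393] -/
theorem norm_Qp_le (hL : 1 ≤ L) {V : Site d → Fin d → 𝔸ˣ} (hV : ∀ x κ, V x κ ∈ U1 𝔸) {μ : Site d → 𝔸} {M : ℝ}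
    (hμ : ∀ x, ‖μ x‖ ≤ M) (y : Site d) : ‖Qp L V μ y‖ ≤ M := by
  have hM : 0 ≤ M := (norm_nonneg _).trans (hμ y)
  rw [Qp_eq_sum]
  calc ‖∑ r : Fin d → Fin L, (((L : ℝ) ^ d)⁻¹) • conjR (hol V y (treeWord (boxVec L r))) (μ (y + boxVec L r))‖
      ≤ ∑ _r : Fin d → Fin L, (((L : ℝ) ^ d)⁻¹) * M := by
        refine norm_sum_le_of_le _ fun r _ => ?_
        rw [norm_smul, Real.norm_of_nonneg (by positivity)]
        exact mul_le_mul_of_nonneg_left ((norm_conjR_le (hol_mem hV _ _) _).trans (hμ _)) (by positivity)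
    _ = M := by
        rw [Finset.sum_const, Finset.card_univ, Fintype.card_pi, Finset.prod_const, Finset.card_univ,
          Fintype.card_fin, Fintype.card_fin, nsmul_eq_mul, Nat.cast_pow]
        have hL0 : ((L : ℝ) ^ d) ≠ 0 := by positivity
        field_simp

/-- `|Q′_jλ| ≤ sup|λ|` when every level background `Ū^i` is unit-bounded. [cite: Balaban1985BackgroundPropagators, (3.19) p.393] -/
theorem norm_QpIter_le (hL : 1 ≤ L) {U : Site d → Fin d → 𝔸ˣ} (hU : ∀ j x κ, avgIter L U j x κ ∈ U1 𝔸)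
    {lam : Site d → 𝔸} {M : ℝ} (hlam : ∀ x, ‖lam x‖ ≤ M) : ∀ (j : ℕ) (y : Site d), ‖QpIter L U lam j y‖ ≤ M
  | 0, y => hlam y
  | j + 1, y => by
      rw [QpIter_succ]
      exact norm_Qp_le L hL (hU j) (norm_QpIter_le hL hU hlam j) _

end Composites

/-! ## §2 (3.113) for a pure gauge: the twisted transports, the block frames, `Ũ′` and `Ū′` of `U′ = 1^u` -/

section PureGauge

variable (L : ℕ)

omit [NormedAlgebra ℂ 𝔸] [CompleteSpace 𝔸] in
/-- the twisted transport (58) of the unit configuration is `1`. [cite: Balaban1985Averaging, (58) p.27] -/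
theorem tHol_one_right (U : Site d → Fin d → 𝔸ˣ) (y : Site d) (w : List (Letter d)) :
    tHol U (1 : Site d → Fin d → 𝔸ˣ) y w = 1 := by
  simp [tHol]

omit [NormedAlgebra ℂ 𝔸] [CompleteSpace 𝔸] in
/-- p. 418: *"(R_{c₋}U′)(Γ_{c₋,x}) = u(c₋)R(U(Γ_{c₋,x}))u⁻¹(x)"* (as read; cf. [5] p. 27 after (59)) — the twisted transport of
the pure gauge along a contour `Γ` from `y` to `x = y + disp Γ` is `u(y)·[R(U(Γ))u(x)]⁻¹`.
[cite: Balaban1985BackgroundPropagators, p.418 (3.113)] -/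
theorem tHol_pureGauge (U : Site d → Fin d → 𝔸ˣ) (u : Site d → 𝔸ˣ) (y : Site d) (w : List (Letter d)) :
    tHol U (mgauge U u 1) y w = u y * (Rc (hol U y w) (u (y + disp w)))⁻¹ := by
  rw [tHol_mgauge, tHol_one_right, mul_one]

/-- p. 418: *"We have (U′U)‾_c = u(c₋)Ū_cu⁻¹(c₊)"*, i.e. `Ũ′(c) = (U′U)‾_c Ū_c⁻¹ = u(c₋)·[R̄_c u(c₊)]⁻¹` ([5] (65), (45)).
[cite: Balaban1985BackgroundPropagators, p.418 (3.113)] -/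
theorem tild_pureGauge (U : Site d → Fin d → 𝔸ˣ) (u : Site d → 𝔸ˣ) (q : Site d) (κ : Fin d) :
    tild L U (mgauge U u 1) q κ = u q * (Rc (bavg L U q κ) (u (q + (L : ℤ) • e κ)))⁻¹ := by
  rw [tild_mgauge, tild_one_right, mul_one]

/-- **(3.113) for the pure gauge, the exact form of p. 418's *"hence Ū′_c = (R̄u)(c₋)R̄_c(R̄u)⁻¹(c₊)"***: with the block
frames `w(y) = \overline{R_yU′}` of (3.113) (`B7Eq92Concrete.wframe`) and `ρ(y) := w(y)⁻¹u(y)` (print's `(R̄u)(y)`, via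
*"R_yU′‾ = u(y)(R̄u)⁻¹(y)"*), the one-step average (3.113) (= [5] (89), `dbavgCov`) of `U′ = 1^u` is
`Ū′_c = ρ(c₋)·R̄_c(ρ(c₊)⁻¹)` — for EVERY background and EVERY invertible `u` (group algebra on [5] (59), (89)).
[cite: Balaban1985BackgroundPropagators, (3.113) p.418] -/
theorem dbavgCov_pureGauge (U : Site d → Fin d → 𝔸ˣ) (u : Site d → 𝔸ˣ) (q : Site d) (κ : Fin d) :
    dbavgCov L U (mgauge U u 1) q κ
      = ((wframe L U (mgauge U u 1) q)⁻¹ * u q)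
        * Rc (bavg L U q κ) (((wframe L U (mgauge U u 1) (q + (L : ℤ) • e κ))⁻¹ * u (q + (L : ℤ) • e κ))⁻¹) := by
  rw [dbavgCov_apply, tild_pureGauge]
  simp only [map_inv, map_mul, mul_inv_rev, inv_inv]
  group

end PureGauge

/-! ## §3 "Taking logarithms of both sides, and linear parts in λ": the derivative of `log Ū′` along `u_t = e^{−tλ}` -/

section LinearParts

variable (L : ℕ)

/-- the twisted transport of `U′_t` along `Γ_{y,x}`: `e^{−tλ(y)}·e^{tR(U(Γ_{y,x}))λ(x)}`. [cite: Balaban1985BackgroundPropagators, p.418 (3.113)] -/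
theorem val_tHol_uexp (U : Site d → Fin d → 𝔸ˣ) (lam : Site d → 𝔸) (t : ℂ) (y : Site d) (w : List (Letter d)) :
    ((tHol U (mgauge U (uexp lam t) 1) y w : 𝔸ˣ) : 𝔸)
      = exp (-(t • lam y)) * exp (t • conjR (hol U y w) (lam (y + disp w))) := by
  letI : NormedAlgebra ℚ 𝔸 := NormedAlgebra.restrictScalars ℚ ℂ 𝔸
  rw [tHol_pureGauge, ← map_inv, Units.val_mul, Rc_apply, Units.val_mul, Units.val_mul, uexp, uexp, val_expUnit,
    val_inv_expUnit, val_expUnit, neg_neg, ← exp_units_conj, ← conjR_apply, conjR_smul]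

/-- `Ũ′_t(c) = e^{−tλ(c₋)}·e^{tR̄_cλ(c₊)}`. [cite: Balaban1985BackgroundPropagators, p.418 (3.113)] -/
theorem val_tild_uexp (U : Site d → Fin d → 𝔸ˣ) (lam : Site d → 𝔸) (t : ℂ) (q : Site d) (κ : Fin d) :
    ((tild L U (mgauge U (uexp lam t) 1) q κ : 𝔸ˣ) : 𝔸)
      = exp (-(t • lam q)) * exp (t • conjR (bavg L U q κ) (lam (q + (L : ℤ) • e κ))) := by
  letI : NormedAlgebra ℚ 𝔸 := NormedAlgebra.restrictScalars ℚ ℂ 𝔸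
  rw [tild_pureGauge, ← map_inv, Units.val_mul, Rc_apply, Units.val_mul, Units.val_mul, uexp, uexp, val_expUnit,
    val_inv_expUnit, val_expUnit, neg_neg, ← exp_units_conj, ← conjR_apply, conjR_smul]

/-- a product `e^{−ta}e^{tb}` has derivative `b − a` at `t = 0`. [folklore] -/
private theorem hasDerivAt_exp_neg_mul_exp (a b : 𝔸) :
    HasDerivAt (fun t : ℂ => exp (-(t • a)) * exp (t • b)) (b - a) 0 := by
  have h1 : HasDerivAt (fun t : ℂ => exp (-(t • a))) (-a) 0 := by
    simpa only [smul_neg] using hasDerivAt_exp_smul_zero (-a)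
  have h := h1.fun_mul (hasDerivAt_exp_smul_zero b)
  simp only [zero_smul, neg_zero, exp_zero, mul_one, one_mul] at h
  exact h.congr_deriv (by abel)

/-- linear part of `log (R_yU′_t)(Γ_{y,x})`: `R(U(Γ_{y,x}))λ(x) − λ(y)`. [cite: Balaban1985BackgroundPropagators, p.418 (3.113)–(3.114)] -/
theorem hasDerivAt_mlog_tHol_uexp (U : Site d → Fin d → 𝔸ˣ) (lam : Site d → 𝔸) (y : Site d) (w : List (Letter d)) :
    HasDerivAt (fun t : ℂ => mlog ((tHol U (mgauge U (uexp lam t) 1) y w : 𝔸ˣ) : 𝔸))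
      (conjR (hol U y w) (lam (y + disp w)) - lam y) 0 := by
  simp only [val_tHol_uexp]
  exact hasDerivAt_mlog_comp (by simp) (hasDerivAt_exp_neg_mul_exp _ _)

/-- **the linear part of the block frame** `\overline{R_yU′_t}` of (3.113) (`= exp Σ_{x∈B(y)}L^{−d} log(R_yU′_t)(Γ_{y,x})`)
is `(Q′λ)(y) − λ(y)` — print's *"R_yU′‾ = u(y)(R̄u)⁻¹(y)"* to first order, the linear part of `R̄u` being `Q′λ`
(p. 394: *"The above averaging operators Q′_j(U) are linear parts of the averaging operations R̄u^j"*).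
[cite: Balaban1985BackgroundPropagators, (3.113) p.418, p.394] -/
theorem hasDerivAt_Fcov_uexp (hL : 1 ≤ L) (U : Site d → Fin d → 𝔸ˣ) (lam : Site d → 𝔸) (y : Site d) :
    HasDerivAt (fun t : ℂ => Fcov L U (mgauge U (uexp lam t) 1) y) (Qp L U lam y - lam y) 0 := by
  unfold Fcov
  have h : HasDerivAt (fun t : ℂ => ∑ r : Fin d → Fin L,
      (((L : ℝ) ^ d)⁻¹) • mlog ((tHol U (mgauge U (uexp lam t) 1) y (treeWord (boxVec L r)) : 𝔸ˣ) : 𝔸))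
      (∑ r : Fin d → Fin L, (((L : ℝ) ^ d)⁻¹) •
        (conjR (hol U y (treeWord (boxVec L r))) (lam (y + boxVec L r)) - lam y)) 0 := by
    refine HasDerivAt.fun_sum fun r _ => ?_
    have h := hasDerivAt_mlog_tHol_uexp U lam y (treeWord (boxVec L r))
    rw [disp_treeWord] at h
    exact h.const_smul (((L : ℝ) ^ d)⁻¹)
  simpa only [smul_sub, Finset.sum_sub_distrib, sum_blockWeight L hL, Qp_eq_sum] using h

/-- at `t = 0` the frame exponent vanishes. [cite: Balaban1985BackgroundPropagators, (3.113) p.418] -/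
theorem Fcov_uexp_zero (U : Site d → Fin d → 𝔸ˣ) (lam : Site d → 𝔸) (y : Site d) :
    Fcov L U (mgauge U (uexp lam 0) 1) y = 0 := by
  unfold Fcov
  exact Finset.sum_eq_zero fun r _ => by rw [mgauge_uexp_zero, tHol_one_right, Units.val_one, mlog_one, smul_zero]

/-- **"Taking logarithms of both sides, and linear parts in λ"** (p. 418, between (3.113) and (3.114)): along
`u_t = e^{−tλ}` the logarithm of the one-step average (3.113) of the pure gauge `U′_t` has derivative
`R̄_c(Q′λ)(c₊) − (Q′λ)(c₋) = (D_ŪQ′λ)(c)` at `t = 0` — the right-hand side of (3.114).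
[cite: Balaban1985BackgroundPropagators, (3.113)–(3.114) p.418] -/
theorem hasDerivAt_mlog_dbavgCov_uexp (hL : 1 ≤ L) (U : Site d → Fin d → 𝔸ˣ) (lam : Site d → 𝔸) (q : Site d)
    (κ : Fin d) :
    HasDerivAt (fun t : ℂ => mlog ((dbavgCov L U (mgauge U (uexp lam t) 1) q κ : 𝔸ˣ) : 𝔸))
      (conjR (bavg L U q κ) (Qp L U lam (q + (L : ℤ) • e κ)) - Qp L U lam q) 0 := by
  -- the three factors of (89): frame⁻¹ at c₋, Ũ′, R̄_c(frame at c₊)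
  have h1 : HasDerivAt (fun t : ℂ => (((wframe L U (mgauge U (uexp lam t) 1) q)⁻¹ : 𝔸ˣ) : 𝔸))
      (-(Qp L U lam q - lam q)) 0 := by
    simp only [wframe, val_inv_expUnit, val_expUnit]
    exact hasDerivAt_exp_comp_zero (by rw [Fcov_uexp_zero, neg_zero]) (hasDerivAt_Fcov_uexp L hL U lam q).neg
  have h2 : HasDerivAt (fun t : ℂ => ((tild L U (mgauge U (uexp lam t) 1) q κ : 𝔸ˣ) : 𝔸))
      (conjR (bavg L U q κ) (lam (q + (L : ℤ) • e κ)) - lam q) 0 := by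
    simp only [val_tild_uexp]
    exact hasDerivAt_exp_neg_mul_exp _ _
  have h3 : HasDerivAt (fun t : ℂ => conjR (bavg L U q κ)
      ((wframe L U (mgauge U (uexp lam t) 1) (q + (L : ℤ) • e κ) : 𝔸ˣ) : 𝔸))
      (conjR (bavg L U q κ) (Qp L U lam (q + (L : ℤ) • e κ) - lam (q + (L : ℤ) • e κ))) 0 := by
    refine hasDerivAt_conjR_comp _ ?_
    simp only [wframe, val_expUnit]
    exact hasDerivAt_exp_comp_zero (by rw [Fcov_uexp_zero]) (hasDerivAt_Fcov_uexp L hL U lam _)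
  have h := (h1.fun_mul h2).fun_mul h3
  have e1 : (((wframe L U (mgauge U (uexp lam 0) 1) q)⁻¹ : 𝔸ˣ) : 𝔸) = 1 := by
    rw [mgauge_uexp_zero, wframe_one_right, inv_one, Units.val_one]
  have e2 : ((tild L U (mgauge U (uexp lam 0) 1) q κ : 𝔸ˣ) : 𝔸) = 1 := by
    rw [mgauge_uexp_zero, tild_one_right, Units.val_one]
  have e3 : conjR (bavg L U q κ) ((wframe L U (mgauge U (uexp lam 0) 1) (q + (L : ℤ) • e κ) : 𝔸ˣ) : 𝔸) = 1 := by
    rw [mgauge_uexp_zero, wframe_one_right, Units.val_one, conjR_one]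
  simp only [e1, e2, e3, mul_one, one_mul] at h
  have hval : ∀ t : ℂ, mlog ((dbavgCov L U (mgauge U (uexp lam t) 1) q κ : 𝔸ˣ) : 𝔸)
      = mlog ((((wframe L U (mgauge U (uexp lam t) 1) q)⁻¹ : 𝔸ˣ) : 𝔸)
          * ((tild L U (mgauge U (uexp lam t) 1) q κ : 𝔸ˣ) : 𝔸)
          * conjR (bavg L U q κ) ((wframe L U (mgauge U (uexp lam t) 1) (q + (L : ℤ) • e κ) : 𝔸ˣ) : 𝔸)) := by
    intro t
    rw [dbavgCov_apply, Units.val_mul, Units.val_mul, conjR_apply, Rc_apply, Units.val_mul, Units.val_mul]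
  simp_rw [hval]
  refine (hasDerivAt_mlog_comp (by rw [e1, e2, e3, mul_one, mul_one]) h).congr_deriv ?_
  rw [conjR_sub]
  abel

end LinearParts

end Literature.MathematicalPhysics.QuantumFieldTheory.Balaban1983to89.B9Eq3113Proof

end
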